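import Summits.SmoothPoincare4.SmoothPoincare4.Theses.EntropyRung
import Summits.SmoothPoincare4.SmoothPoincare4.Theorems.EntropyRungSubcylindricalExistenceCutoffFamilyProfiles
import Summits.SmoothPoincare4.SmoothPoincare4.Theorems.EntropyRungSubcylindricalExistenceCutoffFamilyZone
import Summits.SmoothPoincare4.SmoothPoincare4.Theorems.EntropyRungSubcylindricalExistenceCapRealisation
import Summits.SmoothPoincare4.SmoothPoincare4.Theorems.EntropyRungSubcylindricalExistenceFlatChartRadial
import Summits.SmoothPoincare4.SmoothPoincare4.Theorems.EntropyRungSubcylindricalExistenceGluingCutoffBound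
import HarnessLib

/-!
# The radial cut-off family in a flat chart
(crux stmt-SmoothPoincare4-10871 `EntropyRung.SubcylindricalExistence`, line
`fat-conical-core-avr-logsobolev`, helper stub H-cut `helper_cutoffFamily` of lead c4's skeleton)

Data: a smooth Riemannian metric `g` (Levi-Civita) on a closed smooth `4`-manifold `M` of the
summit binder, a point `p`, the chart `φ = extChartAt (𝓡 4) p`, `y₀ = φ p`, a radius `r > 0` with
`closedBall y₀ r ⊆ φ.target` on which `φ⁻¹` is a `g`-isometry, and grid data `1 ≤ ℓ₀ ≤ d`,
`2 ≤ N`, `T₀` with `e^{T₀ + (N−1)d + ℓ₀} < r`; `ρ = ‖φ x − y₀‖`, zones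
`e^{T₀ + id} ≤ ρ ≤ e^{T₀ + id + ℓ₀}` (`i < N`). With the one-variable telescoping family `Fⱼ` of
`helper_cutoffFamily_profiles` (squares summing to `1`, plateaux below `T₀` and above
`T₀ + (N−1)d + ℓ₀`, supports and derivative supports in the zones of `t = log ρ`,
`(Fⱼ')² ≤ C₁/ℓ₀²`) put `Pⱼ(s) = Fⱼ(log(s e^{−2T₀})/2 + T₀)` (`= Fⱼ(log ρ)` at `s = ρ² > 0`,
`= Fⱼ(T₀)` at `s = 0`; smooth on `ℝ`, being locally constant near `0`) and
`χⱼ x = Pⱼ(‖φ x − y₀‖²)` on the open chart ball `{x ∈ φ.source, ρ < r}`, `χⱼ x = δ_{jN}` off it.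

Off the compact core `K = φ⁻¹(closedBall y₀ r ∩ {ρ² ≤ R₁²})`, `R₁ = e^{T₀ + (N−1)d + ℓ₀}`, the two
branches agree (upper plateau), so each `χⱼ` is smooth (`HelperCapRealisationAux` gluing) with
`|∇χⱼ|² = 0` there; on the chart ball `helper_flatChartRadial` gives
`|∇χⱼ|²_g(φ⁻¹ y) = 4 s Pⱼ'(s)² = Fⱼ'(log ρ)²/ρ² ≤ C₁/(ℓ₀² ρ²)`, vanishing unless `log ρ` lies in
zone `j − 1` or `j`; the zone integrals `∫ ρ⁻⁴ dV_g = 2π² ℓ₀` are `helper_cutoffFamily_zoneIntegral`.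
Everything is proved; no definition, no named fact. References: R. Schoen, S.-T. Yau (1979), §2;
T. Aubin, *Nonlinear Analysis on Manifolds* (1982), Ch. 6, §6.3 [Aubin1982]; B. O'Neill,
*Semi-Riemannian geometry* (1983), Ch. 3 [ONeill1983]; I. Chavel (2006), §III.3 [Chavel2006].
-/

noncomputable section

open scoped Manifold ContDiff Topology ENNReal NNReal RealInnerProductSpace
open Set Filter Function MeasureTheory
open Literature.Geometry.Lorentzian Literature.Geometry.Riemannian

-- the registered namespace `Summit.SmoothPoincare4.SmoothPoincare4.Theorems` repeats a component
set_option linter.dupNamespace false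

namespace Summit.SmoothPoincare4.SmoothPoincare4.Theorems

namespace HelperCutoffFamilyChartAux

section LogProfile

variable {F : ℝ → ℝ} {T₀ : ℝ}

/-- At `s = ρ² > 0` the log-argument is `log ρ`. [folklore] -/
theorem logArg_sq {ρ : ℝ} (hρ : 0 < ρ) (T₀ : ℝ) :
    Real.log (ρ ^ 2 * Real.exp (-(2 * T₀))) / 2 + T₀ = Real.log ρ := by
  rw [Real.log_mul (by positivity) (Real.exp_pos _).ne', Real.log_pow, Real.log_exp]
  push_cast; ring

/-- The log-profile is smooth on `ℝ` when `F` is smooth and constant on `(-∞, T₀]`: off `0` it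
is a composition of smooth maps, near `0` it is locally constant. [folklore] -/
theorem contDiff_logProfile (hF : ContDiff ℝ ∞ F) (hplateau : ∀ t, t ≤ T₀ → F t = F T₀) :
    ContDiff ℝ ∞ (fun s ↦ F (Real.log (s * Real.exp (-(2 * T₀))) / 2 + T₀)) := by
  refine contDiff_iff_contDiffAt.mpr fun s ↦ ?_
  rcases eq_or_ne s 0 with rfl | h0
  · have hev : (fun s ↦ F (Real.log (s * Real.exp (-(2 * T₀))) / 2 + T₀)) =ᶠ[𝓝 (0 : ℝ)]
        fun _ ↦ F T₀ := by
      have hopen : IsOpen {t : ℝ | |t| < Real.exp (2 * T₀)} :=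
        isOpen_lt continuous_abs continuous_const
      filter_upwards [hopen.mem_nhds (show |(0 : ℝ)| < Real.exp (2 * T₀) by
        simpa using Real.exp_pos _)] with t ht
      apply hplateau
      have hlog : Real.log (t * Real.exp (-(2 * T₀))) ≤ 0 := by
        rw [← Real.log_abs]
        refine Real.log_nonpos (abs_nonneg _) ?_
        rw [abs_mul, abs_of_pos (Real.exp_pos _), Real.exp_neg, ← div_eq_mul_inv,
          div_le_one (Real.exp_pos _)]
        exact ht.le
      linarith
    exact contDiffAt_const.congr_of_eventuallyEq hev
  · exact hF.contDiffAt.comp s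
      ((((contDiffAt_id.mul contDiffAt_const).log
        (mul_ne_zero h0 (Real.exp_pos _).ne')).div_const 2).add contDiffAt_const)

/-- The derivative of the log-profile off `0`: `P'(s) = F'(τ)/(2s)`,
`τ = log(s e^{−2T₀})/2 + T₀`. [folklore] -/
theorem hasDerivAt_logProfile (hF : ContDiff ℝ ∞ F) (T₀ : ℝ) {s : ℝ} (hs : s ≠ 0) :
    HasDerivAt (fun s ↦ F (Real.log (s * Real.exp (-(2 * T₀))) / 2 + T₀))
      (deriv F (Real.log (s * Real.exp (-(2 * T₀))) / 2 + T₀) * (1 / (2 * s))) s := by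
  have h1 : HasDerivAt (fun s ↦ Real.log (s * Real.exp (-(2 * T₀))) / 2 + T₀) (1 / (2 * s)) s := by
    have h := ((((hasDerivAt_id' s).mul_const (Real.exp (-(2 * T₀)))).log
      (mul_ne_zero hs (Real.exp_pos _).ne')).div_const 2).add_const T₀
    exact h.congr_deriv (by field_simp)
  exact ((hF.differentiable (by simp)) _).hasDerivAt.comp s h1

/-- `4 s P'(s)² = F'(τ)²/s` off `0`. [folklore] -/
theorem four_mul_deriv_logProfile_sq (hF : ContDiff ℝ ∞ F) (T₀ : ℝ) {s : ℝ} (hs : s ≠ 0) :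
    4 * s * deriv (fun s ↦ F (Real.log (s * Real.exp (-(2 * T₀))) / 2 + T₀)) s ^ 2 =
      deriv F (Real.log (s * Real.exp (-(2 * T₀))) / 2 + T₀) ^ 2 / s := by
  rw [(hasDerivAt_logProfile hF T₀ hs).deriv]
  field_simp; ring

end LogProfile

section Chart

variable {M : Type} [TopologicalSpace M] [ChartedSpace (EuclideanSpace ℝ (Fin 4)) M]
  {p : M} {r R₁ c : ℝ} {χ : M → ℝ} {prof : ℝ → ℝ}

/-- Off the core `K = φ⁻¹(closedBall y₀ r ∩ {ρ² ≤ R₁²})` the glued function is the constant `c`.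
[folklore] -/
theorem eq_const_of_not_mem_core
    (hχ₂ : ∀ x, ¬ (x ∈ (extChartAt (𝓡 4) p).source ∧
      ‖extChartAt (𝓡 4) p x - extChartAt (𝓡 4) p p‖ < r) → χ x = c)
    (hplat : ∀ x ∈ (extChartAt (𝓡 4) p).source, ‖extChartAt (𝓡 4) p x - extChartAt (𝓡 4) p p‖ < r →
      R₁ < ‖extChartAt (𝓡 4) p x - extChartAt (𝓡 4) p p‖ → χ x = c) {x : M}
    (hx : x ∉ (extChartAt (𝓡 4) p).symm ''
      (Metric.closedBall (extChartAt (𝓡 4) p p) r ∩ {y | ‖y - extChartAt (𝓡 4) p p‖ ^ 2 ≤ R₁ ^ 2})) :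
    χ x = c := by
  by_cases h : x ∈ (extChartAt (𝓡 4) p).source ∧ ‖extChartAt (𝓡 4) p x - extChartAt (𝓡 4) p p‖ < r
  · refine hplat x h.1 h.2 (not_le.mp fun hle ↦ hx ?_)
    exact ⟨extChartAt (𝓡 4) p x, ⟨mem_closedBall_iff_norm.2 h.2.le,
      pow_le_pow_left₀ (norm_nonneg _) hle 2⟩, (extChartAt (𝓡 4) p).left_inv h.1⟩
  · exact hχ₂ x h

/-- Off the core, the glued function is constant near the point. [folklore] -/
theorem eventuallyEq_const_of_not_mem_core [T2Space M]
    (hT : Metric.closedBall (extChartAt (𝓡 4) p p) r ⊆ (extChartAt (𝓡 4) p).target)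
    (hχ₂ : ∀ x, ¬ (x ∈ (extChartAt (𝓡 4) p).source ∧
      ‖extChartAt (𝓡 4) p x - extChartAt (𝓡 4) p p‖ < r) → χ x = c)
    (hplat : ∀ x ∈ (extChartAt (𝓡 4) p).source, ‖extChartAt (𝓡 4) p x - extChartAt (𝓡 4) p p‖ < r →
      R₁ < ‖extChartAt (𝓡 4) p x - extChartAt (𝓡 4) p p‖ → χ x = c) {x : M}
    (hx : x ∉ (extChartAt (𝓡 4) p).symm ''
      (Metric.closedBall (extChartAt (𝓡 4) p p) r ∩ {y | ‖y - extChartAt (𝓡 4) p p‖ ^ 2 ≤ R₁ ^ 2})) :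
    χ =ᶠ[𝓝 x] fun _ ↦ c := by
  filter_upwards [(HelperCapRealisationAux.isClosed_core hT).isOpen_compl.mem_nhds hx] with z hz
    using eq_const_of_not_mem_core hχ₂ hplat hz

/-- **The glued function is smooth**: on the core it is `prof(‖· − y₀‖²) ∘ φ` near the point,
off the core it is locally constant. [folklore] -/
theorem contMDiff_glued [T2Space M] [IsManifold (𝓡 4) ∞ M]
    (hT : Metric.closedBall (extChartAt (𝓡 4) p p) r ⊆ (extChartAt (𝓡 4) p).target)
    (hr : 0 < r) (hR₁ : 0 < R₁) (hR₁r : R₁ < r) (hprof : ContDiff ℝ ∞ prof)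
    (hχ₁ : ∀ x ∈ (extChartAt (𝓡 4) p).source, ‖extChartAt (𝓡 4) p x - extChartAt (𝓡 4) p p‖ < r →
      χ x = prof (‖extChartAt (𝓡 4) p x - extChartAt (𝓡 4) p p‖ ^ 2))
    (hχ₂ : ∀ x, ¬ (x ∈ (extChartAt (𝓡 4) p).source ∧
      ‖extChartAt (𝓡 4) p x - extChartAt (𝓡 4) p p‖ < r) → χ x = c)
    (hplat : ∀ x ∈ (extChartAt (𝓡 4) p).source, ‖extChartAt (𝓡 4) p x - extChartAt (𝓡 4) p p‖ < r →
      R₁ < ‖extChartAt (𝓡 4) p x - extChartAt (𝓡 4) p p‖ → χ x = c) :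
    ContMDiff (𝓡 4) 𝓘(ℝ, ℝ) ∞ χ := by
  intro x
  by_cases hx : x ∈ (extChartAt (𝓡 4) p).symm ''
      (Metric.closedBall (extChartAt (𝓡 4) p p) r ∩ {y | ‖y - extChartAt (𝓡 4) p p‖ ^ 2 ≤ R₁ ^ 2})
  · obtain ⟨hxs, hxr⟩ := HelperCapRealisationAux.mem_chartBall_of_mem_core hT hr
      (by nlinarith : R₁ ^ 2 < r ^ 2) hx
    have hP : ContDiff ℝ ∞ fun z : EuclideanSpace ℝ (Fin 4) ↦
        prof (‖z - extChartAt (𝓡 4) p p‖ ^ 2) :=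
      hprof.comp ((contDiff_id.sub contDiff_const).norm_sq ℝ)
    have hxs' : x ∈ (chartAt (EuclideanSpace ℝ (Fin 4)) p).source := by
      rwa [← extChartAt_source (𝓡 4)]
    exact (hP.contDiffAt.comp_contMDiffAt (contMDiffAt_extChartAt' hxs')).congr_of_eventuallyEq
      (HelperCapRealisationAux.eventuallyEq_chart hχ₁ hxs hxr)
  · exact contMDiffAt_const.congr_of_eventuallyEq
      (eventuallyEq_const_of_not_mem_core hT hχ₂ hplat hx)

/-- On the open chart ball the glued function read in the chart is the profile. [folklore] -/
theorem glued_comp_symm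
    (hT : Metric.closedBall (extChartAt (𝓡 4) p p) r ⊆ (extChartAt (𝓡 4) p).target)
    (hχ₁ : ∀ x ∈ (extChartAt (𝓡 4) p).source, ‖extChartAt (𝓡 4) p x - extChartAt (𝓡 4) p p‖ < r →
      χ x = prof (‖extChartAt (𝓡 4) p x - extChartAt (𝓡 4) p p‖ ^ 2)) :
    ∀ y ∈ Metric.ball (extChartAt (𝓡 4) p p) r,
      χ ((extChartAt (𝓡 4) p).symm y) = prof (‖y - extChartAt (𝓡 4) p p‖ ^ 2) := fun y hy ↦ by
  have hyT := hT (Metric.ball_subset_closedBall hy)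
  have h := hχ₁ ((extChartAt (𝓡 4) p).symm y) ((extChartAt (𝓡 4) p).map_target hyT)
  rw [(extChartAt (𝓡 4) p).right_inv hyT] at h
  exact h (mem_ball_iff_norm.1 hy)

end Chart

end HelperCutoffFamilyChartAux

/-- **H-cut — the radial cut-off family in a flat chart** (registered helper stub
`helper_cutoffFamily` of line `fat-conical-core-avr-logsobolev`). See the module docstring:
`χⱼ = Pⱼ(‖φ · − y₀‖²)` on the chart ball and `δ_{jN}` off it, with the telescoping profiles of
`helper_cutoffFamily_profiles`; smoothness by gluing off a compact core
(`HelperCutoffFamilyChartAux.contMDiff_glued`), gradients by the flat-chart radial calculus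
(`helper_flatChartRadial`), zone integrals by `helper_cutoffFamily_zoneIntegral`.
[cite: Aubin1982, Ch. 6, §6.3] -/
theorem helper_cutoffFamily :
    ∃ C₀ : ℝ, 0 < C₀ ∧ ∀ (M : Type) [TopologicalSpace M] [T2Space M] [SecondCountableTopology M]
      [ChartedSpace (EuclideanSpace ℝ (Fin 4)) M] [IsManifold (𝓡 4) ∞ M] [CompactSpace M]
      [T3Space M] [MeasurableSpace M] [BorelSpace M]
      (g : PseudoRiemannianMetric (𝓡 4) ∞ (EuclideanSpace ℝ (Fin 4)) (TangentSpace (𝓡 4) : M → Type _))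
      [g.HasLeviCivita] (hg : g.IsRiemannian) (p : M) (r : ℝ),
      (Metric.closedBall (extChartAt (𝓡 4) p p) r ⊆ (extChartAt (𝓡 4) p).target ∧
        ∀ y ∈ Metric.closedBall (extChartAt (𝓡 4) p p) r, ∀ X W : EuclideanSpace ℝ (Fin 4),
          g.val ((extChartAt (𝓡 4) p).symm y)
            (mfderiv 𝓘(ℝ, EuclideanSpace ℝ (Fin 4)) (𝓡 4) (extChartAt (𝓡 4) p).symm y X)
            (mfderiv 𝓘(ℝ, EuclideanSpace ℝ (Fin 4)) (𝓡 4) (extChartAt (𝓡 4) p).symm y W) = ⟪X, W⟫) →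
      0 < r → ∀ (ℓ₀ d T₀ : ℝ) (N : ℕ), 1 ≤ ℓ₀ → ℓ₀ ≤ d → 2 ≤ N →
      Real.exp (T₀ + (N - 1) * d + ℓ₀) < r →
      ∃ χ : Fin (N + 1) → M → ℝ,
        (∀ j, ContMDiff (𝓡 4) 𝓘(ℝ, ℝ) ∞ (χ j)) ∧ (∀ x, ∑ j, χ j x ^ 2 = 1) ∧
        -- supports: cap piece, annulus pieces, core piece
        (∀ x, χ 0 x ≠ 0 → x ∈ (extChartAt (𝓡 4) p).source ∧
          ‖extChartAt (𝓡 4) p x - extChartAt (𝓡 4) p p‖ < Real.exp (T₀ + ℓ₀)) ∧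
        (∀ (j : Fin (N + 1)) (x : M), 0 < (j : ℕ) → (j : ℕ) < N → χ j x ≠ 0 →
          x ∈ (extChartAt (𝓡 4) p).source ∧
            Real.exp (T₀ + ((j : ℕ) - 1) * d) < ‖extChartAt (𝓡 4) p x - extChartAt (𝓡 4) p p‖ ∧
            ‖extChartAt (𝓡 4) p x - extChartAt (𝓡 4) p p‖ < Real.exp (T₀ + (j : ℕ) * d + ℓ₀)) ∧
        (∀ x, χ (Fin.last N) x ≠ 0 → x ∈ (extChartAt (𝓡 4) p).source →
          ‖extChartAt (𝓡 4) p x - extChartAt (𝓡 4) p p‖ < r →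
            Real.exp (T₀ + (N - 1) * d) < ‖extChartAt (𝓡 4) p x - extChartAt (𝓡 4) p p‖) ∧
        -- gradients live in the zones, with the logarithmic cut-off bound
        (∀ (j : Fin (N + 1)) (x : M), g.gradSq (χ j) x ≠ 0 →
          x ∈ (extChartAt (𝓡 4) p).source ∧
            ∃ i : ℕ, i < N ∧ ((i : ℕ) = (j : ℕ) ∨ i + 1 = (j : ℕ)) ∧
              Real.exp (T₀ + i * d) ≤ ‖extChartAt (𝓡 4) p x - extChartAt (𝓡 4) p p‖ ∧
              ‖extChartAt (𝓡 4) p x - extChartAt (𝓡 4) p p‖ ≤ Real.exp (T₀ + i * d + ℓ₀)) ∧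
        (∀ (j : Fin (N + 1)) (x : M), x ∈ (extChartAt (𝓡 4) p).source →
          g.gradSq (χ j) x ≤ C₀ / (ℓ₀ ^ 2 * ‖extChartAt (𝓡 4) p x - extChartAt (𝓡 4) p p‖ ^ 2)) ∧
        -- each zone has logarithmic `ρ⁻⁴`-volume
        (∀ i : ℕ, i < N →
          ∫ x in {x | x ∈ (extChartAt (𝓡 4) p).source ∧
              Real.exp (T₀ + i * d) ≤ ‖extChartAt (𝓡 4) p x - extChartAt (𝓡 4) p p‖ ∧
              ‖extChartAt (𝓡 4) p x - extChartAt (𝓡 4) p p‖ ≤ Real.exp (T₀ + i * d + ℓ₀)},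
            (‖extChartAt (𝓡 4) p x - extChartAt (𝓡 4) p p‖ ^ 4)⁻¹
            ∂(riemannianMeasure (g.toContMDiffRiemannianMetric hg)) ≤ 2 * Real.pi ^ 2 * ℓ₀ + 1) := by
  classical
  obtain ⟨C₁, hC₁, hfam⟩ := helper_cutoffFamily_profiles
  refine ⟨C₁, hC₁, ?_⟩
  intro M _ _ _ _ _ _ _ _ _ g _ hg p r hflat hr ℓ₀ d T₀ N hℓ hℓd hN hR
  obtain ⟨F, hFs, hsum, hbelow, habove, hsupp0, hsuppj, hsuppN, hdzone, hdbound⟩ :=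
    hfam ℓ₀ d T₀ N hℓ hℓd hN
  have hT := hflat.1
  have hd0 : 0 ≤ d := by linarith
  -- the upper plateau radius and the core
  set R₁ : ℝ := Real.exp (T₀ + (N - 1) * d + ℓ₀) with hR₁
  have hR₁pos : 0 < R₁ := Real.exp_pos _
  set K : Set M := (extChartAt (𝓡 4) p).symm ''
    (Metric.closedBall (extChartAt (𝓡 4) p p) r ∩
      {y | ‖y - extChartAt (𝓡 4) p p‖ ^ 2 ≤ R₁ ^ 2}) with hK
  -- the log-profiles, the plateau values and the family
  set P : ℕ → ℝ → ℝ := fun j s ↦ F j (Real.log (s * Real.exp (-(2 * T₀))) / 2 + T₀) with hP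
  set c : ℕ → ℝ := fun j ↦ if j = N then 1 else 0 with hc
  set χ : ℕ → M → ℝ := fun j x ↦
    if x ∈ (extChartAt (𝓡 4) p).source ∧ ‖extChartAt (𝓡 4) p x - extChartAt (𝓡 4) p p‖ < r then
      P j (‖extChartAt (𝓡 4) p x - extChartAt (𝓡 4) p p‖ ^ 2) else c j with hχ
  have hχ₁ : ∀ j, ∀ x ∈ (extChartAt (𝓡 4) p).source,
      ‖extChartAt (𝓡 4) p x - extChartAt (𝓡 4) p p‖ < r →
        χ j x = P j (‖extChartAt (𝓡 4) p x - extChartAt (𝓡 4) p p‖ ^ 2) :=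
    fun j x hxs hxr ↦ if_pos ⟨hxs, hxr⟩
  have hχ₂ : ∀ j x, ¬ (x ∈ (extChartAt (𝓡 4) p).source ∧
      ‖extChartAt (𝓡 4) p x - extChartAt (𝓡 4) p p‖ < r) → χ j x = c j := fun j x h ↦ if_neg h
  -- the lower plateau makes the log-profiles smooth
  have hplateau : ∀ j t, t ≤ T₀ → F j t = F j T₀ := by
    intro j t ht
    rcases Nat.eq_zero_or_pos j with rfl | hj
    · rw [(hbelow t ht).1, (hbelow T₀ le_rfl).1]
    · rw [(hbelow t ht).2 j hj, (hbelow T₀ le_rfl).2 j hj]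
  have hPs : ∀ j, ContDiff ℝ ∞ (P j) := fun j ↦
    HelperCutoffFamilyChartAux.contDiff_logProfile (hFs j) (hplateau j)
  -- values on the punctured chart ball and at the pole
  have hval : ∀ j, ∀ x ∈ (extChartAt (𝓡 4) p).source,
      ‖extChartAt (𝓡 4) p x - extChartAt (𝓡 4) p p‖ < r →
      0 < ‖extChartAt (𝓡 4) p x - extChartAt (𝓡 4) p p‖ →
        χ j x = F j (Real.log ‖extChartAt (𝓡 4) p x - extChartAt (𝓡 4) p p‖) := by
    intro j x hxs hxr hρ
    rw [hχ₁ j x hxs hxr]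
    exact congrArg (F j) (HelperCutoffFamilyChartAux.logArg_sq hρ T₀)
  have hval0 : ∀ j, ∀ x ∈ (extChartAt (𝓡 4) p).source,
      ‖extChartAt (𝓡 4) p x - extChartAt (𝓡 4) p p‖ = 0 → χ j x = F j T₀ := by
    intro j x hxs hρ
    rw [hχ₁ j x hxs (by rw [hρ]; exact hr), hP]
    dsimp only; rw [hρ]; simp
  -- the upper plateau: beyond `R₁` the chart branch is the constant `c j`
  have hplat : ∀ j, j ≤ N → ∀ x ∈ (extChartAt (𝓡 4) p).source,
      ‖extChartAt (𝓡 4) p x - extChartAt (𝓡 4) p p‖ < r →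
        R₁ < ‖extChartAt (𝓡 4) p x - extChartAt (𝓡 4) p p‖ → χ j x = c j := by
    intro j hj x hxs hxr hρ
    have hρ0 : 0 < ‖extChartAt (𝓡 4) p x - extChartAt (𝓡 4) p p‖ := hR₁pos.trans hρ
    rw [hval j x hxs hxr hρ0]
    have ht : T₀ + (N - 1) * d + ℓ₀ ≤ Real.log ‖extChartAt (𝓡 4) p x - extChartAt (𝓡 4) p p‖ :=
      (Real.le_log_iff_exp_le hρ0).2 hρ.le
    obtain ⟨hN1, hlt⟩ := habove _ ht
    simp only [hc]
    split_ifs with hjN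
    · subst hjN; exact hN1
    · exact hlt j (lt_of_le_of_ne hj hjN)
  -- smoothness, constancy off the core, chart representative and gradient formula
  have hsmooth : ∀ j, j ≤ N → ContMDiff (𝓡 4) 𝓘(ℝ, ℝ) ∞ (χ j) := fun j hj ↦
    HelperCutoffFamilyChartAux.contMDiff_glued hT hr hR₁pos hR (hPs j) (hχ₁ j) (hχ₂ j) (hplat j hj)
  have hgrad0 : ∀ j, j ≤ N → ∀ x, x ∉ K → g.gradSq (χ j) x = 0 := fun j hj x hx ↦
    GluingCutoffBound.gradSq_eq_zero_of_eventuallyEq_const g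
      (HelperCutoffFamilyChartAux.eventuallyEq_const_of_not_mem_core hT (hχ₂ j) (hplat j hj) hx)
  have hchart : ∀ j, ∀ y ∈ Metric.ball (extChartAt (𝓡 4) p p) r,
      χ j ((extChartAt (𝓡 4) p).symm y) = P j (‖y - extChartAt (𝓡 4) p p‖ ^ 2) := fun j ↦
    HelperCutoffFamilyChartAux.glued_comp_symm hT (hχ₁ j)
  have hgrad : ∀ j, ∀ x ∈ (extChartAt (𝓡 4) p).source,
      ‖extChartAt (𝓡 4) p x - extChartAt (𝓡 4) p p‖ < r →
        g.gradSq (χ j) x = 4 * ‖extChartAt (𝓡 4) p x - extChartAt (𝓡 4) p p‖ ^ 2 *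
          deriv (P j) (‖extChartAt (𝓡 4) p x - extChartAt (𝓡 4) p p‖ ^ 2) ^ 2 := by
    intro j x hxs hxr
    have h := (helper_flatChartRadial M g p r (χ j) (P j) hr hflat (hPs j) (hchart j)
      (extChartAt (𝓡 4) p x) (mem_ball_iff_norm.2 hxr)).2.1
    rwa [(extChartAt (𝓡 4) p).left_inv hxs] at h
  -- the core lies in the open chart ball and contains the whole chart ball of radius `R₁`
  have hKball : ∀ x ∈ K, x ∈ (extChartAt (𝓡 4) p).source ∧
      ‖extChartAt (𝓡 4) p x - extChartAt (𝓡 4) p p‖ < r := fun x hx ↦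
    HelperCapRealisationAux.mem_chartBall_of_mem_core hT hr (by nlinarith : R₁ ^ 2 < r ^ 2) hx
  have hjle : ∀ j : Fin (N + 1), (j : ℕ) ≤ N := fun j ↦ Nat.lt_succ_iff.mp j.isLt
  refine ⟨fun j ↦ χ j, fun j ↦ hsmooth j (hjle j), ?_, ?_, ?_, ?_, ?_, ?_, ?_⟩
  · -- squares sum to one
    intro x
    rw [Fin.sum_univ_eq_sum_range (fun j ↦ χ j x ^ 2) (N + 1)]
    by_cases hx : x ∈ (extChartAt (𝓡 4) p).source ∧
        ‖extChartAt (𝓡 4) p x - extChartAt (𝓡 4) p p‖ < r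
    · rw [Finset.sum_congr rfl fun j _ ↦ by rw [hχ₁ j x hx.1 hx.2]]
      exact hsum _
    · rw [Finset.sum_congr rfl fun j _ ↦ by rw [hχ₂ j x hx]]
      simp [hc, Finset.sum_ite_eq', Finset.mem_range]
  · -- support of the cap piece
    intro x hx0
    dsimp only at hx0
    simp only [Fin.val_zero] at hx0
    by_cases hx : x ∈ (extChartAt (𝓡 4) p).source ∧
        ‖extChartAt (𝓡 4) p x - extChartAt (𝓡 4) p p‖ < r
    · refine ⟨hx.1, ?_⟩
      rcases (norm_nonneg (extChartAt (𝓡 4) p x - extChartAt (𝓡 4) p p)).eq_or_lt with hρ | hρ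
      · rw [← hρ]; exact Real.exp_pos _
      · rw [hval 0 x hx.1 hx.2 hρ] at hx0
        exact (Real.log_lt_iff_lt_exp hρ).1 (hsupp0 _ hx0)
    · exact absurd (by rw [hχ₂ 0 x hx, hc]; simp; omega) hx0
  · -- supports of the annulus pieces
    intro j x hj hjN hx0
    dsimp only at hx0
    by_cases hx : x ∈ (extChartAt (𝓡 4) p).source ∧
        ‖extChartAt (𝓡 4) p x - extChartAt (𝓡 4) p p‖ < r
    · refine ⟨hx.1, ?_⟩
      rcases (norm_nonneg (extChartAt (𝓡 4) p x - extChartAt (𝓡 4) p p)).eq_or_lt with hρ | hρ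
      · exact absurd (by rw [hval0 j x hx.1 hρ.symm]; exact (hbelow T₀ le_rfl).2 j hj) hx0
      · rw [hval j x hx.1 hx.2 hρ] at hx0
        obtain ⟨h1, h2⟩ := hsuppj j _ hj hjN hx0
        exact ⟨(Real.lt_log_iff_exp_lt hρ).1 h1, (Real.log_lt_iff_lt_exp hρ).1 h2⟩
    · exact absurd (by rw [hχ₂ j x hx, hc]; simp; omega) hx0
  · -- support of the core piece
    intro x hx0 hxs hxr
    dsimp only at hx0
    simp only [Fin.val_last] at hx0
    rcases (norm_nonneg (extChartAt (𝓡 4) p x - extChartAt (𝓡 4) p p)).eq_or_lt with hρ | hρ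
    · exact absurd (by rw [hval0 N x hxs hρ.symm]; exact (hbelow T₀ le_rfl).2 N (by omega)) hx0
    · rw [hval N x hxs hxr hρ] at hx0
      exact (Real.lt_log_iff_exp_lt hρ).1 (hsuppN _ hx0)
  · -- gradients live in the zones
    intro j x hD
    dsimp only at hD
    by_cases hxK : x ∈ K
    · obtain ⟨hxs, hxr⟩ := hKball x hxK
      refine ⟨hxs, ?_⟩
      rw [hgrad j x hxs hxr] at hD
      have hs : ‖extChartAt (𝓡 4) p x - extChartAt (𝓡 4) p p‖ ^ 2 ≠ 0 :=
        fun h ↦ hD (by rw [h]; ring)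
      have hρ : 0 < ‖extChartAt (𝓡 4) p x - extChartAt (𝓡 4) p p‖ :=
        (norm_nonneg _).lt_of_ne' (fun h ↦ hs (by rw [h]; ring))
      rw [hP, HelperCutoffFamilyChartAux.four_mul_deriv_logProfile_sq (hFs j) T₀ hs,
        HelperCutoffFamilyChartAux.logArg_sq hρ] at hD
      have hD' : deriv (F j) (Real.log ‖extChartAt (𝓡 4) p x - extChartAt (𝓡 4) p p‖) ≠ 0 :=
        fun h ↦ hD (by rw [h]; ring)
      obtain ⟨i, hi, hij, h1, h2⟩ := hdzone j _ (hjle j) hD'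
      exact ⟨i, hi, hij, (Real.le_log_iff_exp_le hρ).1 h1, (Real.log_le_iff_le_exp hρ).1 h2⟩
    · exact absurd (hgrad0 j (hjle j) x hxK) hD
  · -- the logarithmic cut-off bound
    intro j x hxs
    dsimp only
    by_cases hxr : ‖extChartAt (𝓡 4) p x - extChartAt (𝓡 4) p p‖ < r
    · rw [hgrad j x hxs hxr]
      rcases eq_or_ne (‖extChartAt (𝓡 4) p x - extChartAt (𝓡 4) p p‖ ^ 2) 0 with hs | hs
      · rw [hs]
        simp only [mul_zero, zero_mul]
        positivity
      · rw [hP, HelperCutoffFamilyChartAux.four_mul_deriv_logProfile_sq (hFs j) T₀ hs, ← div_div]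
        exact div_le_div_of_nonneg_right (hdbound j _) (sq_nonneg _)
    · have hxK : x ∉ K := fun h ↦ hxr (hKball x h).2
      rw [hgrad0 j (hjle j) x hxK]
      positivity
  · -- the zone integrals
    intro i hi
    have hi' : (i : ℝ) ≤ N - 1 := by
      have : (i : ℝ) + 1 ≤ N := by exact_mod_cast hi
      linarith
    have hb : Real.exp (T₀ + i * d + ℓ₀) ≤ r := by
      refine le_trans (Real.exp_le_exp.2 ?_) hR.le
      nlinarith
    rw [helper_cutoffFamily_zoneIntegral M g hg p r hflat _ _ (Real.exp_pos _)
      (Real.exp_le_exp.2 (by linarith)) hb, ← Real.exp_sub, Real.log_exp]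
    nlinarith [Real.pi_pos]

end Summit.SmoothPoincare4.SmoothPoincare4.Theorems

end
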